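import Mathlib
import Summits.Ventures.HodgeRepro2.T6N1WitGram3

/-!
# T6N1WitMain — THE NON-DEGENERATE N1 INSTANCE: the four N1 displays hold jointly on a shadow with a
non-zero period and a non-zero pairing (README §10.5(ii)(d) for N1; STATUS l. 11284 (S1)–(S6); owner t6-p1)

The period datum `ndatum D σ₀` (choices `ℂ⁴`, admissible = NORMALISED `c.1 · c.2.1 = 1 ∧ c.2.2.1 · c.2.2.2 = 1`,
the doubled surface shadow of T6N1WitAlg–Gram2 with the lead's B-side, base embedding `σ₀`, generators
`e_{i,σ₀}`) and the N1 datum `n1datum D σ₀` (conjugation `conj2`, `H10 = ι(U)`, dictionary `sc`, `c_K = 1`,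
parameters `F_A c = (c.1 c.2.1) • sc(ω_A)`, `F_B c = (c.2.2.1 c.2.2.2) • sc(ω_B)`) satisfy
`Hyp.Voisin2002_7_3_2`, `Hyp.Voisin2002_Lemma5_4_petersson`, `Hyp.Liu2021_Prop4_13_vertexLiftA` and
`…vertexLiftB` simultaneously (`displays`), the period is non-zero at every choice (`I_ne_zero`, so the
displayed (N) holds on the shadow: `periodN`), and the pairing is non-zero at every admissible choice
(`pairing_ne_zero`, through `N1Main.I_eq`) — the instance is NON-DEGENERATE, and `N1_main`'s conclusion is
non-vacuous on it (`n1_main_nonvacuous`). Compare T6N1Toy (degenerate) and T6N1Obstruction (no such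
instance exists on a carrier with `data_surj`). No `sorry`; standard axioms.
§8(d): uses an L-value-free non-vanishing device: NO.
-/

namespace Summit.Ventures.HodgeRepro2.T6.N1Wit

open ExteriorAlgebra Conj NumberField
open scoped InnerProductSpace

variable {K : Type} [Field K] [NumberField K] {F : FaceSetting K} (D : WitData F) (σ₀ : K →+* ℂ)

namespace WitData

/-! ## 1. The surface side and the period datum -/

/-- THE SURFACE SIDE: the lead's B-side data (`ToyN.toyNData`) with the doubled surface shadow
`HS := ⋀(V × V)`, `f^* := ⋀(inl)`, `∫_S := λ₁ + λ₂`, `z := e_{sᶜ}`. -/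
noncomputable def shadowData : OfData.ShadowData F where
  Alg := (ToyN.toyNData F (D.heK σ₀)).Alg
  alg_deg := (ToyN.toyNData F (D.heK σ₀)).alg_deg
  alg_one := (ToyN.toyNData F (D.heK σ₀)).alg_one
  alg_mul := (ToyN.toyNData F (D.heK σ₀)).alg_mul
  alg_pull := (ToyN.toyNData F (D.heK σ₀)).alg_pull
  alg_lefschetz := (ToyN.toyNData F (D.heK σ₀)).alg_lefschetz
  intB := (ToyN.toyNData F (D.heK σ₀)).intB
  intB_deg := (ToyN.toyNData F (D.heK σ₀)).intB_deg
  intB_ne_zero := (ToyN.toyNData F (D.heK σ₀)).intB_ne_zero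
  alg_pont_even := (ToyN.toyNData F (D.heK σ₀)).alg_pont_even
  HS := HS2 K
  pull := pull2
  intS := lam1 (D.heK σ₀) + D.lam2P σ₀
  z := ToyN.zN (D.heK σ₀)
  z_deg := ToyN.zN_mem F (D.heK σ₀)
  z_alg := ToyN.zN_mem F (D.heK σ₀)
  z_proj := fun u => by
    rw [LinearMap.add_apply, lam1_pull2, D.lam2P_pull2, add_zero]
    exact (ToyN.toyNData F (D.heK σ₀)).z_proj u

/-- The generators: the eigenbasis vectors `e_{i,σ'}` at every embedding `σ'`. -/
noncomputable def gen (σ' : K →+* ℂ) (i : Fin 4) : H1C K := D.E.eB (i, σ')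

/-- `gen σ' i ∈ ℓ_{i,σ'}`. -/
theorem gen_mem (σ' : K →+* ℂ) (i : Fin 4) : D.gen σ' i ∈ eigenLine K i σ' := by
  rw [D.E.eigen]
  exact Submodule.mem_span_singleton_self _

/-- THE PERIOD DATUM: choices `ℂ⁴`, admissible = normalised, the doubled shadow, base `σ₀`. -/
noncomputable def ndatum : NDatum F where
  Choice := ℂ × ℂ × ℂ × ℂ
  AdmChoice c := c.1 * c.2.1 = 1 ∧ c.2.2.1 * c.2.2.2 = 1
  shadow _ := TransferShadow.ofData (D.shadowData σ₀)
  τ₁ := σ₀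
  e := D.gen
  e_mem := D.gen_mem

/-- The period at every choice is the lead's `topCoeff(e_{sᶜ} · e_0 ∧ e_1 ∧ e_2 ∧ e_3)`. -/
theorem I_eq_intSN (c : (D.ndatum σ₀).Choice) :
    (D.ndatum σ₀).I σ₀ c = ToyN.intSN (D.heK σ₀) (ToyN.eigenMon (D.eK σ₀)) := by
  show (lam1 (D.heK σ₀) + D.lam2P σ₀) (pull2 (ι ℂ (D.E.eB (0, σ₀)) * ι ℂ (D.E.eB (1, σ₀)) *
    ι ℂ (D.E.eB (2, σ₀)) * ι ℂ (D.E.eB (3, σ₀)))) = _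
  rw [LinearMap.add_apply, lam1_pull2, D.lam2P_pull2, add_zero]
  simp only [D.heB, LinearMap.single_apply]
  rfl

/-- THE PERIOD IS NON-ZERO at every choice (the lead's `ToyN.sN_spec`). -/
theorem I_ne_zero (c : (D.ndatum σ₀).Choice) : (D.ndatum σ₀).I σ₀ c ≠ 0 := by
  rw [D.I_eq_intSN, ToyN.intSN_apply, ToyN.extC_zN]
  exact ToyN.sN_spec (D.heK σ₀)

/-- The displayed (N) holds on the shadow of every choice. -/
theorem periodN (c : (D.ndatum σ₀).Choice) : Hyp.PeriodN ((D.ndatum σ₀).shadow c) :=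
  (D.ndatum σ₀).periodN_of_I_ne_zero (D.I_ne_zero σ₀ c)

/-! ## 3. The N1 datum -/

/-- `ω_A := f^*(e_{i_A}) · f^*(e_{j_A})`. -/
noncomputable def omegaA : HS2 K :=
  pull2 (ι ℂ (D.E.eB ((pairA (F := F) σ₀).1.1, σ₀))) * pull2 (ι ℂ (D.E.eB ((pairA (F := F) σ₀).1.2, σ₀)))

/-- `ω_B := conj f^*(e_{k_B}) · conj f^*(e_{l_B})`. -/
noncomputable def omegaB : HS2 K :=
  conj2 (pull2 (ι ℂ (D.E.eB ((pairB (F := F) σ₀).1.1, σ₀)))) *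
    conj2 (pull2 (ι ℂ (D.E.eB ((pairB (F := F) σ₀).1.2, σ₀))))

/-- `F_A c := (c.1 c.2.1) • sc ω_A`. -/
noncomputable def FA (c : (D.ndatum σ₀).Choice) : LGw K := (c.1 * c.2.1) • D.scP σ₀ (D.omegaA σ₀)

/-- `F_B c := (c.2.2.1 c.2.2.2) • sc ω_B`. -/
noncomputable def FB (c : (D.ndatum σ₀).Choice) : LGw K :=
  (c.2.2.1 * c.2.2.2) • D.scP σ₀ (D.omegaB σ₀)

/-- THE N1 DATUM of the witness. -/
noncomputable def n1datum : N1Datum F (D.ndatum σ₀) (LGw K) (D.FA σ₀) (D.FB σ₀) where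
  conj _ := conj2
  conj_smul _ := conj2_smul
  conj_conj _ := conj2_conj2
  H10 _ := D.H10
  sc _ := D.scP σ₀
  cK := 1
  cK_pos := one_pos

/-! ## 4. The four displays -/

/-- THE PETERSSON IDENTITY on `H20 × H20`: `∫_S ω ∧ conj ω' = ⟪sc ω', sc ω⟫`. -/
theorem petersson {ω ω' : HS2 K} (hω : ω ∈ D.H10 * D.H10) (hω' : ω' ∈ D.H10 * D.H10) :
    (lam1 (D.heK σ₀) + D.lam2P σ₀) (ω * conj2 ω') =
      ⟪D.scP σ₀ ω', D.scP σ₀ ω⟫_ℂ := by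
  have hω₁ := D.mul_H10_le_span_pairs hω
  have hω₁' := D.mul_H10_le_span_pairs hω'
  have key : ∀ p ∈ pairs F, ∀ x ∈ Submodule.span ℂ (D.eS '' (pairs F : Set (Finset (Fin (nJ K))))),
      (lam1 (D.heK σ₀) + D.lam2P σ₀) (D.eS p * conj2 x) =
        ⟪D.scP σ₀ x, D.scP σ₀ (D.eS p)⟫_ℂ := by
    intro p hp x hx
    induction hx using Submodule.span_induction with
    | mem x hx =>
      obtain ⟨q, hq, rfl⟩ := hx
      exact D.intS_eS_pairP σ₀ hp (Finset.mem_coe.1 hq)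
    | zero => simp
    | add x y _ _ hx hy => rw [map_add, mul_add, map_add, hx, hy, map_add, inner_add_left]
    | smul a x _ hx =>
      rw [conj2_smul, mul_smul_comm, map_smul, hx, map_smul, inner_smul_left, smul_eq_mul]
  clear hω hω'
  induction hω₁ using Submodule.span_induction with
  | mem x hx =>
    obtain ⟨p, hp, rfl⟩ := hx
    exact key p (Finset.mem_coe.1 hp) ω' hω₁'
  | zero => simp
  | add x y _ _ hx hy => rw [add_mul, map_add, hx, hy, map_add, inner_add_right]
  | smul a x _ hx => rw [smul_mul_assoc, map_smul, hx, map_smul, inner_smul_right, smul_eq_mul]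

/-- THE FOUR N1 DISPLAYS HOLD JOINTLY on the witness (README §10.5(ii)(d)). -/
theorem displays :
    Hyp.Voisin2002_7_3_2 (D.n1datum σ₀) ∧ Hyp.Voisin2002_Lemma5_4_petersson (D.n1datum σ₀) ∧
      Hyp.Liu2021_Prop4_13_vertexLiftA (D.n1datum σ₀) ∧ Hyp.Liu2021_Prop4_13_vertexLiftB (D.n1datum σ₀) := by
  refine ⟨fun c => ⟨fun v hv => D.pull2_ι_mem_H10 hv, fun v hv => D.conj2_pull2_ι_mem_H10 hv⟩,
    ?_, ?_, ?_⟩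
  · intro c _ ω hω ω' hω'
    change (lam1 (D.heK σ₀) + D.lam2P σ₀) ((show HS2 K from ω) * conj2 (show HS2 K from ω')) =
      ((1 : ℝ) : ℂ) * ⟪D.scP σ₀ (show HS2 K from ω'), D.scP σ₀ (show HS2 K from ω)⟫_ℂ
    rw [Complex.ofReal_one, one_mul]
    exact D.petersson σ₀ hω hω'
  · intro c hc i j hij hi hj
    obtain ⟨rfl, rfl⟩ := eq_pairA σ₀ hij hi hj
    change D.scP σ₀ (D.omegaA σ₀) = D.FA σ₀ c
    rw [FA, hc.1, one_smul]
  · intro c hc k l hkl hk hl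
    obtain ⟨rfl, rfl⟩ := eq_pairB σ₀ hkl hk hl
    change D.scP σ₀ (D.omegaB σ₀) = D.FB σ₀ c
    rw [FB, hc.2, one_smul]

/-! ## 5. Non-degeneracy -/

/-- THE PAIRING IS NON-ZERO at every admissible choice (through `N1Main.I_eq` and `I_ne_zero`). -/
theorem pairing_ne_zero (c : (D.ndatum σ₀).Choice) (hc : (D.ndatum σ₀).AdmChoice c) :
    (D.n1datum σ₀).pairing c ≠ 0 := by
  obtain ⟨hH, hL, hA, hB⟩ := D.displays σ₀
  intro h0
  have hI := D.I_ne_zero σ₀ c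
  have hτ : (D.ndatum σ₀).I σ₀ c = (D.ndatum σ₀).I (D.ndatum σ₀).τ₁ c := rfl
  rcases N1Main.I_eq (D.n1datum σ₀) hH hL hA hB c hc with h | h
  · exact hI (by rw [hτ, h, h0, mul_zero])
  · exact hI (by rw [hτ, h, h0, mul_zero, neg_zero])

/-- `N1_main` on the witness is NON-VACUOUS: at every admissible choice both the pairing and the period are
non-zero, and the implication `pairing ≠ 0 → I ≠ 0` is witnessed with both sides true. -/
theorem n1_main_nonvacuous (c : (D.ndatum σ₀).Choice) (hc : (D.ndatum σ₀).AdmChoice c) :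
    (D.n1datum σ₀).pairing c ≠ 0 ∧ (D.ndatum σ₀).I (D.ndatum σ₀).τ₁ c ≠ 0 :=
  ⟨D.pairing_ne_zero σ₀ c hc, D.I_ne_zero σ₀ c⟩

/-- The admissible choices are non-empty (`(1, 1, 1, 1)`). -/
theorem admChoice_nonempty : ∃ c, (D.ndatum σ₀).AdmChoice c :=
  ⟨((1 : ℂ), (1 : ℂ), (1 : ℂ), (1 : ℂ)), by simp [ndatum]⟩

/-! ## 6. Proportionality: `sc ω_B = λ • sc ω_A` (the lead's STATUS l. 11351 (2)(α)) -/

/-- `ω_A = u • e_{p_A}` (a sign). -/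
theorem omegaA_eq : ∃ u : ℤˣ, D.omegaA σ₀ = u • D.eS (pA (F := F) σ₀) := by
  have hne : aL σ₀ (pairA (F := F) σ₀).1.1 ≠ aL σ₀ (pairA (F := F) σ₀).1.2 :=
    (aL_injective σ₀).ne (pairA (F := F) σ₀).2.1.ne
  obtain ⟨u, hu⟩ := D.eS_mul_eS_of_disjoint (Finset.disjoint_singleton.2 hne)
  refine ⟨u, ?_⟩
  rw [omegaA, pull2_ι, pull2_ι, ← D.bI_inl, ← D.bI_inl, ← D.eS_singleton, ← D.eS_singleton, pA,
    Finset.insert_eq]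
  exact hu

/-- `ω_B = d • e_{q_B}`, `d ≠ 0`. -/
theorem omegaB_eq : ∃ d : ℂ, d ≠ 0 ∧ D.omegaB σ₀ = d • D.eS (qB (F := F) σ₀) := by
  obtain ⟨c1, hc10, hc1⟩ := D.exists_conjH1_eB (pairB (F := F) σ₀).1.1 σ₀
  obtain ⟨c2, hc20, hc2⟩ := D.exists_conjH1_eB (pairB (F := F) σ₀).1.2 σ₀
  have hne : aR σ₀ (pairB (F := F) σ₀).1.1 ≠ aR σ₀ (pairB (F := F) σ₀).1.2 :=
    (aR_injective σ₀).ne (pairB (F := F) σ₀).2.1.ne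
  obtain ⟨u, hu⟩ := D.eS_mul_eS_of_disjoint (Finset.disjoint_singleton.2 hne)
  have hunit : ((u : ℤ) : ℂ) ≠ 0 := by exact_mod_cast u.ne_zero
  refine ⟨c1 * c2 * ((u : ℤ) : ℂ), mul_ne_zero (mul_ne_zero hc10 hc20) hunit, ?_⟩
  have hsm : ∀ (c : ℂ) (x : H1C K), ((0 : H1C K), c • x) = c • ((0, x) : V2 K) := by
    intro c x; simp
  rw [omegaB, conj2_pull2_ι, conj2_pull2_ι, hc1, hc2, hsm, hsm, map_smul, map_smul,
    smul_mul_smul_comm, ← D.bI_inr, ← D.bI_inr, ← D.eS_singleton, ← D.eS_singleton]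
  have hu' : D.eS {idx K (Sum.inr ((pairB (F := F) σ₀).1.1, ComplexEmbedding.conjugate σ₀))} *
      D.eS {idx K (Sum.inr ((pairB (F := F) σ₀).1.2, ComplexEmbedding.conjugate σ₀))} =
      u • D.eS ({aR σ₀ (pairB (F := F) σ₀).1.1} ∪ {aR σ₀ (pairB (F := F) σ₀).1.2}) := hu
  rw [hu', units_smul_eq, smul_smul, qB, Finset.insert_eq]

/-- `sc ω_A = u • f_{p_A}`, `u ≠ 0`. -/
theorem scP_omegaA : ∃ u : ℂ, u ≠ 0 ∧ D.scP σ₀ (D.omegaA σ₀) = u • fvec (pA (F := F) σ₀) := by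
  obtain ⟨u, hu⟩ := D.omegaA_eq σ₀
  refine ⟨((u : ℤ) : ℂ), by exact_mod_cast u.ne_zero, ?_⟩
  rw [hu, units_smul_eq, map_smul, D.scP_eS, D.scValP_pA]

/-- `sc ω_B = (d · conj M₀) • f_{p_A}`, `d ≠ 0`. -/
theorem scP_omegaB : ∃ d : ℂ, d ≠ 0 ∧
    D.scP σ₀ (D.omegaB σ₀) = (d * starRingEnd ℂ (D.M0 σ₀)) • fvec (pA (F := F) σ₀) := by
  obtain ⟨d, hd0, hd⟩ := D.omegaB_eq σ₀
  refine ⟨d, hd0, ?_⟩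
  rw [hd, map_smul, D.scP_eS, D.scValP_qB, smul_smul]

/-- `f_{p} ≠ 0`. -/
theorem fvec_ne_zero (p : Finset (Fin (nJ K))) : fvec (K := K) p ≠ 0 := by
  intro h
  have := congrArg (fun v : LGw K => v p) h
  simp [fvec] at this

/-- `sc ω_A ≠ 0`. -/
theorem scP_omegaA_ne_zero : D.scP σ₀ (D.omegaA σ₀) ≠ 0 := by
  obtain ⟨u, hu0, hu⟩ := D.scP_omegaA σ₀
  rw [hu]
  exact smul_ne_zero hu0 (fvec_ne_zero _)

/-- THE SCALAR (the lead's l. 11351 (2)(α)): `sc ω_B = λ • sc ω_A` with `λ ≠ 0` — the two automorphic vectors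
of the witness span the same line, as t6-p3's proportionality boundary (T6N3TrivGroup v2) requires. -/
theorem scP_omegaB_eq_smul : ∃ l : ℂ, l ≠ 0 ∧ D.scP σ₀ (D.omegaB σ₀) = l • D.scP σ₀ (D.omegaA σ₀) := by
  obtain ⟨u, hu0, hu⟩ := D.scP_omegaA σ₀
  obtain ⟨d, hd0, hd⟩ := D.scP_omegaB σ₀
  have hM : starRingEnd ℂ (D.M0 σ₀) ≠ 0 := (map_ne_zero _).2 (D.M0_ne_zero σ₀)
  refine ⟨d * starRingEnd ℂ (D.M0 σ₀) / u, div_ne_zero (mul_ne_zero hd0 hM) hu0, ?_⟩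
  rw [hd, hu, smul_smul, div_mul_cancel₀ _ hu0]

end WitData

/-- NON-VACUITY OF THE N1 DISPLAYS WITH A NON-ZERO PAIRING, FOR EVERY FACE SETTING (README §10.5(ii)(d)):
there are a period datum `P`, an automorphic space `LG`, parameters `FA FB` and an N1 datum `d` on which the
four displays hold jointly, with an admissible choice `c` of non-zero pairing and non-zero period. -/
theorem exists_nondegenerate (F : FaceSetting K) :
    ∃ (P : NDatum F) (FA FB : P.Choice → WitData.LGw K) (d : N1Datum F P (WitData.LGw K) FA FB),
      (Hyp.Voisin2002_7_3_2 d ∧ Hyp.Voisin2002_Lemma5_4_petersson d ∧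
        Hyp.Liu2021_Prop4_13_vertexLiftA d ∧ Hyp.Liu2021_Prop4_13_vertexLiftB d) ∧
      ∃ c, P.AdmChoice c ∧ d.pairing c ≠ 0 ∧ P.I P.τ₁ c ≠ 0 := by
  obtain ⟨D⟩ := exists_witData F
  obtain ⟨σ₀⟩ := (inferInstance : Nonempty (K →+* ℂ))
  obtain ⟨c, hc⟩ := D.admChoice_nonempty σ₀
  exact ⟨D.ndatum σ₀, D.FA σ₀, D.FB σ₀, D.n1datum σ₀, D.displays σ₀, c, hc,
    D.pairing_ne_zero σ₀ c hc, D.I_ne_zero σ₀ c⟩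

end Summit.Ventures.HodgeRepro2.T6.N1Wit
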